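import Summits.ABC.IUTFork.LDHGenuinePerImagePrintInd1
import Summits.ABC.IUTFork.Thm311RealInd1StripPacketHullWashout
import Summits.ABC.IUTFork.Thm311RealInd1StripOrbitSpan
import HarnessLib

/-!
# [IUTchIII] Thm 3.11 (i) (Ind1)+(Ind2) on a TENSOR PACKET of genuine completions: print's factorwise group MULTIPLIES THE PACKET TRACE BY A UNIT,
# so its orbit of a region `M ⊆ c·log_p(R_I^×)` stays in the ceiling `M + c·(log_p(R_I^×) ∩ Ker Tr_V)` (UNCONDITIONAL) — whose hull is the
# container's as soon as one factor is tame of degree `≥ 2` (`Thm311RealInd1StripPacketHullWashout`)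

PROOF-ONLY file (abc-iut cell, Cor. 3.12 sub-crew, seat abc-iut-c312-1 = holder of record of the typed [IUTchIII] Thm. 3.11, gen 15; row
«R20 = PACKET-HULL-WASHOUT», file 2; STAGED for TEAM R c312-14 / the C LEAD's ruling).  TAKES NO SIDE on [IUTchIII] Cor. 3.12.

* §1 (one place, UNCONDITIONAL) **`exists_unit_trace_mul_of_mem_closure_ind`** — every `γ` in the subgroup of `Aut_ℚ(K_v)` generated by print's
  (Ind1) strip part `Real.ind1Strip (analyticLogv F) v` and print's (Ind2) `Real.ismIsm (analyticLogv F) v` multiplies the trace by a UNIT of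
  `ℚ_p`: `Tr_{K_v/ℚ_p}(γ x) = u_γ·Tr_{K_v/ℚ_p}(x)`, `‖u_γ‖ = 1` (strip generators: `u = 1`, R13 `trace_apply_eq_of_mem_ind1StripOf`; (Ind2): the unit
  homothety scalar, abc-iut-w5-d216; closed under products and inverses) — the scalar form of gen 14's orbit invariant (p516833 §1);
* §2 (genuine packet `X = ⊗_{ℚ_p, i} K_{w_i}`, UNCONDITIONAL) **`exists_unit_trace_mul_of_factorwise_printInd1Ind2`** — a `ℚ_p`-linear `g` acting on
  pure tensors factorwise through such `γ_i` multiplies `Tr_{X/ℚ_p}` by the unit `Π_i u_{γ_i}` (`Tr_X(⊗ z_i) = Π_i Tr(z_i)`, abc-iut-S6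
  `trace_purePacket`); hence **`image_subset_add_inter_ker_of_factorwise_printInd1Ind2`** — for every `ℤ_p`-stable region `M ⊆ c·log_p(R_I^×)`:
  `g(M) ⊆ M + (c·log_p(R_I^×) ∩ Ker Tr_X)` (the packet CEILING; `g` preserves `c·log_p(R_I^×)`, p516014 / `image_logPacket_congr`); and with the
  washout (one tame factor of degree `≥ 2`, p5xxxxx) **`packetHull_iUnion_image_subset_of_factorwise_printInd1Ind2`**: the `(R_I)^∼`-hull of the
  whole print-(Ind1)⊔(Ind2) orbit of `M` lies in `packetHull(M ∪ c·(log_p(R_I^×) ∩ Ker Tr_X)) = packetHull(c·log_p(R_I^×))` — the hull of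
  Dupuy–Hilado's container orbit span (`TensorPacketOrbitSpan`): at the hull level the trace ceiling of print's factorwise group is EXACTLY the
  container's, so the per-image / union Θ-sides of [IUTchIII] Cor. 3.12 computed over print's (Ind1)⊔(Ind2) can fall below the container's ONLY
  through the failure of the orbit to reach its ceiling (general position; the conditional floor), never through trace rigidity;
* §3 `realPrimePacketWith_lnνLp_hull_orbitH_eq_negLogThetaPerImageAt_of_forall_eq` — the EQUALITY CRITERION for reading (P) over any
  sub-indeterminacy `H` (abc-iut-c312-d1's vocabulary, p503117): summandwise hull equality with the container orbit ⇒ the `H`-reading IS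
  `−|log(Θ)|^{(P)}_p`.
HONEST SCOPE: OUR typings (THE equivariant lift, THE logarithm, factorwise action as in p516014's `hg`; F-B28-1 untouched); nothing here computes a
log-volume; wild factors / all-degree-one packets named in the washout file; no side taken on [IUTchIII] Cor. 3.12; NO abc claim.
[claim: Mochizuki2012, status: disputed]; [cite: Mochizuki2012, IUTchIII Thm. 3.11 (i) p. 154; Rmk. 3.9.5 (i) p. 127; Cor. 3.12 Step (xi) p. 183];
[cite: HoshiNishio2022OuterAutMLF, Lemma 2.3 (ii)]; [cite: DupuyHilado2025, §4.9, §4.12]. typed ≠ proved.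
-/

set_option autoImplicit false

noncomputable section

open Metric Set
open scoped Pointwise TensorProduct

namespace Summit.ABC.IUTFork.Thm311.Real

open NumberField IsDedekindDomain Literature.NumberTheory.NumberFields Literature.IUT.LogVolume
open Literature.NumberTheory.GaloisRepresentations Literature.NumberTheory.GaloisRepresentations.Ultrametric
open Literature.AnabelianGeometry.AbsoluteAnabelian Literature.IUT.HodgeArakelov
open Literature.IUT.HodgeArakelov.AbsTopMonoids Literature.IUT.LogThetaLattice

/-! ## §1 One place: print's (Ind1)⊔(Ind2) group multiplies the trace by a unit -/

section OnePlace

variable {F : Type} [Field F] [NumberField F] (v : HeightOneSpectrum (𝓞 F))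
variable (p : ℕ) [hp : Fact p.Prime] (hv : ((p : ℕ) : 𝓞 F) ∈ v.asIdeal)

/-- **Every element of print's (Ind1)⊔(Ind2) group at `v` multiplies `Tr_{K_v/ℚ_p}` by a unit of `ℚ_p` (UNCONDITIONAL).**  For `γ` in the
subgroup generated by `Real.ind1Strip (analyticLogv F) v ∪ Real.ismIsm (analyticLogv F) v` there is `u ∈ ℚ_p`, `‖u‖ = 1`, with
`Tr(γ x) = u·Tr(x)` for all `x ∈ K_v` (read in `K_v^{(1/n_v)}`): strip automorphisms PRESERVE the trace (R13, Hoshi–Nishio Lemma 2.3 (ii)), print's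
(Ind2) acts by unit homotheties (abc-iut-w5-d216), and the property is closed under composition and inverses.
[claim: Mochizuki2012, status: disputed] [cite: HoshiNishio2022OuterAutMLF, Lemma 2.3 (ii) p. 7] [cite: Mochizuki2012, IUTchIII Thm. 3.11 (i) p. 154] -/
theorem exists_unit_trace_mul_of_mem_closure_ind
    {γ : Carrier (.inr v : Place F) ≃ₗ[ℚ] Carrier (.inr v : Place F)}
    (hγ : γ ∈ Subgroup.closure (ind1Strip (analyticLogv F) v ∪ ismIsm (analyticLogv F) v)) :
    ∃ u : ℚ_[p], ‖u‖ = 1 ∧ ∀ x : v.adicCompletion F,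
      Algebra.trace ℚ_[p] (RescaledCompletion F p v hv) (RescaledCompletion.of F p v hv (γ x)) =
        u * Algebra.trace ℚ_[p] (RescaledCompletion F p v hv) (RescaledCompletion.of F p v hv x) := by
  obtain rfl : p = (closureAt v).residueChar := eq_residueChar_closureAt_of_natCast_mem v hv
  set e := RescaledCompletion.of F (closureAt v).residueChar v hv with he
  set Tr := Algebra.trace ℚ_[(closureAt v).residueChar] (RescaledCompletion F (closureAt v).residueChar v hv) with hTr
  induction hγ using Subgroup.closure_induction with
  | mem δ hδ =>
    rcases hδ with hδ | hδ
    · refine ⟨1, norm_one, fun x => ?_⟩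
      have h := (mem_ind1Strip_iff (analyticLogv F) v δ).mp hδ
      rw [← galoisLog_eq_analyticLogv v] at h
      rw [one_mul]
      exact trace_apply_eq_of_mem_ind1StripOf v h x
    · obtain ⟨u, hu1, hu⟩ := exists_unit_scalar_of_mem_ismIsm_analyticLogv (closureAt v).residueChar v hv hδ
      refine ⟨u, hu1, fun x => ?_⟩
      rw [show e (δ x) = u • e x from hu x, map_smul, smul_eq_mul]
  | one =>
    refine ⟨1, norm_one, fun x => ?_⟩
    rw [one_mul]; rfl
  | mul δ₁ δ₂ _ _ h₁ h₂ =>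
    obtain ⟨u₁, hu₁, h₁⟩ := h₁
    obtain ⟨u₂, hu₂, h₂⟩ := h₂
    refine ⟨u₁ * u₂, by rw [norm_mul, hu₁, hu₂, one_mul], fun x => ?_⟩
    rw [LinearEquiv.mul_apply, h₁, h₂, mul_assoc]
  | inv δ _ h =>
    obtain ⟨u, hu1, hu⟩ := h
    have hu0 : u ≠ 0 := norm_ne_zero_iff.mp (by rw [hu1]; exact one_ne_zero)
    refine ⟨u⁻¹, by rw [norm_inv, hu1, inv_one], fun x => ?_⟩
    have h := hu (δ⁻¹ x)
    rw [show δ (δ⁻¹ x) = x from δ.apply_symm_apply x] at h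
    rw [h, ← mul_assoc, inv_mul_cancel₀ hu0, one_mul]

end OnePlace

/-! ## §2 The genuine tensor packet: the trace scalar of a factorwise print element, and the packet ceiling -/

section Packet

variable {K : Type} [Field K] [NumberField K] (p : ℕ) [hp : Fact p.Prime]
variable {I : Type} [Fintype I] (w : I → HeightOneSpectrum (𝓞 K)) (hw : ∀ i, ((p : ℕ) : 𝓞 K) ∈ (w i).asIdeal)

/-- **A factorwise print-(Ind1)⊔(Ind2) element multiplies the PACKET trace by a unit (UNCONDITIONAL).**  On `X = ⊗_{ℚ_p, i} K_{w_i}` (genuine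
completions, rescaled), a `ℚ_p`-linear `g` acting on pure tensors factorwise through elements `γ_i` of the subgroups generated by print's (Ind1) strip
part and print's (Ind2) at `w_i` satisfies `Tr_{X/ℚ_p}(g y) = u·Tr_{X/ℚ_p}(y)` for all `y`, with `u = Π_i u_{γ_i}`, `‖u‖ = 1`
(`Tr_X(⊗ z_i) = Π_i Tr(z_i)`). [claim: Mochizuki2012, status: disputed] [cite: Mochizuki2012, IUTchIII Thm. 3.11 (i) p. 154]
[cite: HoshiNishio2022OuterAutMLF, Lemma 2.3 (ii) p. 7] -/
theorem exists_unit_trace_mul_of_factorwise_printInd1Ind2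
    (γ : ∀ i, Carrier (.inr (w i) : Thm311.Real.Place K) ≃ₗ[ℚ] Carrier (.inr (w i) : Thm311.Real.Place K))
    (hγ : ∀ i, γ i ∈ Subgroup.closure (ind1Strip (analyticLogv K) (w i) ∪ ismIsm (analyticLogv K) (w i)))
    (g : PacketAlgebra p (fun i => RescaledCompletion K p (w i) (hw i)) →ₗ[ℚ_[p]]
      PacketAlgebra p (fun i => RescaledCompletion K p (w i) (hw i)))
    (hg : ∀ x : Π i, RescaledCompletion K p (w i) (hw i),
      g (PiTensorProduct.tprod ℚ_[p] x) =
        PiTensorProduct.tprod ℚ_[p] (fun i =>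
          RescaledCompletion.of K p (w i) (hw i) (γ i ((RescaledCompletion.of K p (w i) (hw i)).symm (x i))))) :
    ∃ u : ℚ_[p], ‖u‖ = 1 ∧ ∀ y,
      Algebra.trace ℚ_[p] (PacketAlgebra p (fun i => RescaledCompletion K p (w i) (hw i))) (g y) =
        u * Algebra.trace ℚ_[p] (PacketAlgebra p (fun i => RescaledCompletion K p (w i) (hw i))) y := by
  choose u hu1 hu using fun i => exists_unit_trace_mul_of_mem_closure_ind (w i) p (hw i) (hγ i)
  refine ⟨∏ i, u i, by rw [norm_prod]; exact Finset.prod_eq_one fun i _ => hu1 i, fun y => ?_⟩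
  set TrX := Algebra.trace ℚ_[p] (PacketAlgebra p (fun i => RescaledCompletion K p (w i) (hw i))) with hTrX
  induction y using PiTensorProduct.induction_on with
  | smul_tprod r x =>
    rw [map_smul, map_smul, hg, map_smul, smul_eq_mul, smul_eq_mul]
    have h1 := trace_purePacket p (fun i => RescaledCompletion K p (w i) (hw i))
      (fun i => RescaledCompletion.of K p (w i) (hw i) (γ i ((RescaledCompletion.of K p (w i) (hw i)).symm (x i))))
    have h2 := trace_purePacket p (fun i => RescaledCompletion K p (w i) (hw i)) x
    simp only [purePacket] at h1 h2
    rw [h1, h2, mul_left_comm, ← Finset.prod_mul_distrib]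
    congr 1
    refine Finset.prod_congr rfl fun i _ => ?_
    have h := hu i ((RescaledCompletion.of K p (w i) (hw i)).symm (x i))
    rwa [RingEquiv.apply_symm_apply] at h
  | add a b ha hb => rw [map_add, map_add, ha, hb, map_add, mul_add]

/-- **THE PACKET CEILING OF PRINT's FACTORWISE (Ind1)⊔(Ind2) (UNCONDITIONAL).**  Same setting, `g` a `ℚ_p`-linear AUTOMORPHISM acting factorwise
through print's single-place groups; for every `c ∈ ℚ_p` and every `ℤ_p`-stable additive subgroup `M ⊆ c·log_p(R_I^×)`:
`g(M) ⊆ M + (c·log_p(R_I^×) ∩ Ker Tr_{X/ℚ_p})` — `g x = u·x + (g x − u·x)` with `u·x ∈ M` (`‖u‖ = 1`) and `g x − u·x ∈ c·log_p(R_I^×)` (`g`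
preserves `log_p(R_I^×)`: p516014 / `image_logPacket_congr`) of packet trace `0`. [claim: Mochizuki2012, status: disputed]
[cite: Mochizuki2012, IUTchIII Thm. 3.11 (i) p. 154] [cite: DupuyHilado2025, §4.9] -/
theorem image_subset_add_inter_ker_of_factorwise_printInd1Ind2
    (γ : ∀ i, Carrier (.inr (w i) : Thm311.Real.Place K) ≃ₗ[ℚ] Carrier (.inr (w i) : Thm311.Real.Place K))
    (hγ : ∀ i, γ i ∈ Subgroup.closure (ind1Strip (analyticLogv K) (w i) ∪ ismIsm (analyticLogv K) (w i)))
    (g : PacketAlgebra p (fun i => RescaledCompletion K p (w i) (hw i)) ≃ₗ[ℚ_[p]]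
      PacketAlgebra p (fun i => RescaledCompletion K p (w i) (hw i)))
    (hg : ∀ x : Π i, RescaledCompletion K p (w i) (hw i),
      g (PiTensorProduct.tprod ℚ_[p] x) =
        PiTensorProduct.tprod ℚ_[p] (fun i =>
          RescaledCompletion.of K p (w i) (hw i) (γ i ((RescaledCompletion.of K p (w i) (hw i)).symm (x i)))))
    (c : ℚ_[p]) (M : AddSubgroup (PacketAlgebra p (fun i => RescaledCompletion K p (w i) (hw i))))
    (hMs : ∀ a : ℚ_[p], ‖a‖ ≤ 1 → ∀ z ∈ M, a • z ∈ M)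
    (hM : (M : Set (PacketAlgebra p (fun i => RescaledCompletion K p (w i) (hw i)))) ⊆
      c • (logPacket p (fun i => RescaledCompletion K p (w i) (hw i)) : Set _)) :
    g '' (M : Set (PacketAlgebra p (fun i => RescaledCompletion K p (w i) (hw i)))) ⊆
      (M : Set _) + (c • (logPacket p (fun i => RescaledCompletion K p (w i) (hw i)) : Set _) ∩
        {y | Algebra.trace ℚ_[p] (PacketAlgebra p (fun i => RescaledCompletion K p (w i) (hw i))) y = 0}) := by
  obtain ⟨u, hu1, hu⟩ := exists_unit_trace_mul_of_factorwise_printInd1Ind2 p w hw γ hγ g.toLinearMap (fun x => hg x)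
  -- `g` lies in the container, hence preserves `log_p(R_I^×)`
  have hg2 : g ∈ indTwo p (fun i => RescaledCompletion K p (w i) (hw i)) := mem_indTwo_of_printInd1Ind2 p w hw γ hγ g hg
  have hgL : ∀ y, y ∈ (logPacket p (fun i => RescaledCompletion K p (w i) (hw i)) : Set _) →
      g y ∈ (logPacket p (fun i => RescaledCompletion K p (w i) (hw i)) : Set _) := by
    intro y hy
    exact (((mem_indTwo_iff p _ g).1 hg2) y).2 hy
  set L := (logPacket p (fun i => RescaledCompletion K p (w i) (hw i)) : Set (PacketAlgebra p (fun i => RescaledCompletion K p (w i) (hw i))))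
    with hL
  have hcL_sub : ∀ a b, a ∈ c • L → b ∈ c • L → a - b ∈ c • L := by
    intro a b ha hb
    obtain ⟨a', ha', rfl⟩ := Set.mem_smul_set.mp ha
    obtain ⟨b', hb', rfl⟩ := Set.mem_smul_set.mp hb
    rw [← smul_sub]
    exact Set.smul_mem_smul_set ((logPacket p _).sub_mem ha' hb')
  rintro _ ⟨x, hx, rfl⟩
  have hxL : x ∈ c • L := hM hx
  have hux : u • x ∈ M := hMs u hu1.le x hx
  have hgx : g x ∈ c • L := by
    obtain ⟨x', hx', rfl⟩ := Set.mem_smul_set.mp hxL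
    rw [map_smul]
    exact Set.smul_mem_smul_set (hgL x' hx')
  refine ⟨u • x, hux, g x - u • x, ⟨hcL_sub _ _ hgx (hM hux), ?_⟩, add_sub_cancel (u • x) (g x)⟩
  change Algebra.trace ℚ_[p] _ (g x - u • x) = 0
  rw [map_sub, map_smul, smul_eq_mul, show Algebra.trace ℚ_[p] _ (g x) = u * _ from hu x, sub_self]

end Packet

/-! ## §3 The equality criterion for the per-image Θ-side over a sub-indeterminacy (any real prime packet) -/

section Transfer

open Literature.IUT.LogVolume.PrimePacket

variable {F : Type} [Field F] [NumberField F] (p : ℕ) [Fact p.Prime] (𝔽 : LocalFields F p)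
variable (c : (j : ℕ) → (Fin (j + 1) → placesOver F p) → ℚ_[p]) (hc0 : ∀ j e, c j e ≠ 0)
  (hcσ : ∀ (j : ℕ) (τ : Equiv.Perm (Fin (j + 1))) (e : Fin (j + 1) → placesOver F p), c j (e ∘ τ) = c j e)

/-- **EQUALITY CRITERION for reading (P) over a sub-indeterminacy.**  For the real prime packet (any shell normalisation), a `p`-local Θ-idele
`t` and ANY family `H` of subgroups of the packet automorphisms: if in every degree `j = i+1 ≤ ℓ⋆` and collection `v⃗` the `(R_I)^∼`-hull of the
`H`-orbit of the Θ-region EQUALS the hull of its container orbit (the slot images), then the reading over `H` IS the container's per-image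
number `−|log(Θ)|^{(P)}_p` (`ln ν̄_{𝕃_p}` reads only these hulls, abc-iut-c312-d1 `lnνLp_congr_of_succ`).  With §2 and
`Thm311RealInd1StripPacketHullWashout`: for print's factorwise (Ind1)⊔(Ind2) the hypothesis holds exactly when the orbit span reaches its
trace-zero ceiling (general position), never failing through trace rigidity. [cite: DupuyHilado2025, §4.9, §4.12]
[cite: Mochizuki2012, IUTchIII Cor. 3.12 proof Step (x) p. 181] [claim: Mochizuki2012, status: disputed] -/
theorem realPrimePacketWith_lnνLp_hull_orbitH_eq_negLogThetaPerImageAt_of_forall_eq {lstar : ℕ}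
    (t : Fin lstar → (v : placesOver F p) → (𝔽.k v)ˣ)
    (H : (j : ℕ) → (e : Fin (j + 1) → placesOver F p) →
      Subgroup (PacketAlgebra p (fun b => 𝔽.k (e b)) ≃ₗ[ℚ_[p]] PacketAlgebra p (fun b => 𝔽.k (e b))))
    (heq : ∀ (i : Fin lstar) (e : Fin ((i : ℕ) + 1 + 1) → placesOver F p),
      packetHull p (fun b => 𝔽.k (e b))
          (⋃ g : H ((i : ℕ) + 1) e, (g : PacketAlgebra p (fun b => 𝔽.k (e b)) ≃ₗ[ℚ_[p]] PacketAlgebra p (fun b => 𝔽.k (e b))) ''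
            (realPrimePacketWith p 𝔽 c hc0 hcσ).pilotRegion t ((i : ℕ) + 1) e) =
        packetHull p (fun b => 𝔽.k (e b))
          ((realPrimePacketWith p 𝔽 c hc0 hcσ).slotImages ((realPrimePacketWith p 𝔽 c hc0 hcσ).pilotRegion t) ((i : ℕ) + 1) e)) :
    (realPrimePacketWith p 𝔽 c hc0 hcσ).lnνLp lstar (fun j e =>
        packetHull p (fun b => 𝔽.k (e b))
          (⋃ g : H j e, (g : PacketAlgebra p (fun b => 𝔽.k (e b)) ≃ₗ[ℚ_[p]] PacketAlgebra p (fun b => 𝔽.k (e b))) ''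
            (realPrimePacketWith p 𝔽 c hc0 hcσ).pilotRegion t j e)) =
      (realPrimePacketWith p 𝔽 c hc0 hcσ).negLogThetaPerImageAt lstar t := by
  unfold PrimePacket.negLogThetaPerImageAt
  exact (realPrimePacketWith p 𝔽 c hc0 hcσ).lnνLp_congr_of_succ lstar fun i e => heq i e

end Transfer

end Summit.ABC.IUTFork.Thm311.Real

end
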